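import Summits.QuantumFields.QCD.Theses.NestedDissectionSea

/-!
# Stub `stub_boxGroundState` of line `mass-wegner-cell-index` for crux `NegativeCellsDilute`
# (stmt-QuantumFields-13900): the Dirichlet ground-state bound of an open box of the four-torus

For a real function `f` on the sites of the discrete torus `(ℤ/N)⁴` supported in the open box of
corner `x` and sides `s ≤ N` (`siteBox x s`: offsets `t_i(y) = (y i − x i).val ∈ (0, s_i)`), the
nearest-neighbour form is bounded by the top of the Dirichlet spectrum of the box (a product of
paths with `s_i − 1` vertices):

  `Σ_y Σ_ν f(y) f(y + e_ν) ≤ (Σ_i cos(π / s_i)) · Σ_y f(y)²`.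

Proof (ground-state substitution).  With the positive supersolution
`Φ(y) = Π_i sin(π t_i(y) / s_i)` on the box and `0` off it (`boxGroundState_supersolution`):

* (AM–GM) `2 f(y) f(y+e_ν) ≤ f(y)² Φ(y+e_ν)/Φ(y) + f(y+e_ν)² Φ(y)/Φ(y+e_ν)` for all `y, ν`
  (with `x / 0 = 0`; off the box `f` vanishes and the right-hand side is non-negative);
* the second double sum is re-indexed by the torus translation `y ↦ y + e_ν`;
* on the box `Σ_ν (Φ(y+e_ν) + Φ(y−e_ν)) = 2 (Σ_ν cos(π/s_ν)) Φ(y)`, from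
  `sin(a+b) + sin(a−b) = 2 sin a cos b` in direction `ν` (the other factors of `Φ` do not change
  under `y ↦ y ± e_ν`), the profile `sin(π t/s_ν)` vanishing on the bounding sheets
  `t ∈ {0, s_ν}` (no wrap-around because `s_ν ≤ N`).

No sign condition on `f` is needed.  Everything is over Mathlib and the tree vocabulary `siteBox`
(`Literature/MathematicalPhysics/QuantumLattice/WilsonCellSchur`); the file declares no
definitions (the supersolution is produced by an existential lemma).
-/

noncomputable section

namespace Summit.QuantumFields.QCD.Cruxes.NegativeCellsDilute.MassWegnerCellIndex

open scoped BigOperators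
open Literature.MathematicalPhysics.QuantumLattice Literature.MathematicalPhysics.QuantumFieldTheory
  Literature.Probability.LatticeModels

/-! ### Offsets `(y i − x i).val` from the corner under unit translations -/

/-- A unit translation in direction `ν` does not change the offsets in the directions `i ≠ ν`. -/
private theorem boxGroundState_off_add_of_ne {N : ℕ} (x y : TorusSite 4 N) {ν i : Fin 4}
    (h : i ≠ ν) : ((y + Pi.single ν 1 : TorusSite 4 N) i - x i).val = (y i - x i).val := by
  simp [Pi.single_eq_of_ne h]

/-- A backward unit translation in direction `ν` does not change the offsets in the directions
`i ≠ ν`. -/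
private theorem boxGroundState_off_sub_of_ne {N : ℕ} (x y : TorusSite 4 N) {ν i : Fin 4}
    (h : i ≠ ν) : ((y - Pi.single ν 1 : TorusSite 4 N) i - x i).val = (y i - x i).val := by
  simp [Pi.single_eq_of_ne h]

/-- In direction `ν` the forward offset is `(t_ν + 1) % N`. -/
private theorem boxGroundState_off_add_self {N : ℕ} [NeZero N] (x y : TorusSite 4 N)
    (ν : Fin 4) :
    ((y + Pi.single ν 1 : TorusSite 4 N) ν - x ν).val = ((y ν - x ν).val + 1) % N := by
  simp only [Pi.add_apply, Pi.single_eq_same]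
  rw [show y ν + 1 - x ν = (y ν - x ν) + 1 by ring, ZMod.val_add, ZMod.val_one_eq_one_mod,
    Nat.add_mod_mod]

/-- In direction `ν`, if `0 < t_ν` the backward offset is `t_ν − 1` (no wrap-around). -/
private theorem boxGroundState_off_sub_self {N : ℕ} [NeZero N] (x y : TorusSite 4 N)
    (ν : Fin 4) (h : 0 < (y ν - x ν).val) :
    ((y - Pi.single ν 1 : TorusSite 4 N) ν - x ν).val = (y ν - x ν).val - 1 := by
  simp only [Pi.sub_apply, Pi.single_eq_same]
  have hlt := ZMod.val_lt (y ν - x ν)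
  have hN : 1 % N = 1 := Nat.mod_eq_of_lt (by omega)
  have h1 : (1 : ZMod N).val ≤ (y ν - x ν).val := by rw [ZMod.val_one_eq_one_mod, hN]; omega
  rw [show y ν - 1 - x ν = (y ν - x ν) - 1 by ring, ZMod.val_sub h1, ZMod.val_one_eq_one_mod, hN]

/-! ### The one-dimensional Dirichlet profile `sin(π r / c)` -/

/-- Sum-to-product: `sin(π(r+1)/c) + sin(π(r−1)/c) = 2 cos(π/c) sin(πr/c)`. -/
private theorem boxGroundState_sin_add_sin (c r : ℝ) :
    Real.sin (Real.pi * (r + 1) / c) + Real.sin (Real.pi * (r - 1) / c) =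
      2 * Real.cos (Real.pi / c) * Real.sin (Real.pi * r / c) := by
  have h1 : Real.pi * (r + 1) / c = Real.pi * r / c + Real.pi / c := by ring
  have h2 : Real.pi * (r - 1) / c = Real.pi * r / c - Real.pi / c := by ring
  rw [h1, h2, Real.sin_add, Real.sin_sub]
  ring

/-- The profile is positive strictly inside: `0 < t < c → 0 < sin(π t / c)`. -/
private theorem boxGroundState_sin_pos {t c : ℕ} (h0 : 0 < t) (h1 : t < c) :
    0 < Real.sin (Real.pi * t / c) := by
  have ht : (0 : ℝ) < t := by exact_mod_cast h0
  have hc : (0 : ℝ) < c := by exact_mod_cast h0.trans h1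
  refine Real.sin_pos_of_pos_of_lt_pi (div_pos (mul_pos Real.pi_pos ht) hc) ?_
  rw [mul_div_assoc]
  exact mul_lt_of_lt_one_right Real.pi_pos ((div_lt_one hc).2 (by exact_mod_cast h1))

/-- The profile vanishes on the upper sheet: `sin(π c / c) = 0` (also when `c = 0`). -/
private theorem boxGroundState_sin_self (c : ℕ) : Real.sin (Real.pi * c / c) = 0 := by
  rcases eq_or_ne (c : ℝ) 0 with h | h
  · rw [h, mul_zero, zero_div, Real.sin_zero]
  · rw [mul_div_assoc, div_self h, mul_one, Real.sin_pi]

/-! ### The separable product `Π_i sin(π t_i(y) / s_i)` and its neighbours -/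

/-- Splitting off the factor of direction `ν` from the product. -/
private theorem boxGroundState_prod_eq {N : ℕ} (x : TorusSite 4 N) (s : Fin 4 → ℕ)
    (y : TorusSite 4 N) (ν : Fin 4) :
    ∏ i, Real.sin (Real.pi * (y i - x i).val / s i) =
      Real.sin (Real.pi * (y ν - x ν).val / s ν) *
        ∏ i ∈ Finset.univ.erase ν, Real.sin (Real.pi * (y i - x i).val / s i) :=
  (Finset.mul_prod_erase Finset.univ (fun i => Real.sin (Real.pi * (y i - x i).val / s i))
    (Finset.mem_univ ν)).symm

/-- The factors in the directions `i ≠ ν` do not change under `y ↦ y + e_ν`. -/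
private theorem boxGroundState_rest_add {N : ℕ} (x : TorusSite 4 N) (s : Fin 4 → ℕ)
    (y : TorusSite 4 N) (ν : Fin 4) :
    ∏ i ∈ Finset.univ.erase ν,
        Real.sin (Real.pi * ((y + Pi.single ν 1 : TorusSite 4 N) i - x i).val / s i) =
      ∏ i ∈ Finset.univ.erase ν, Real.sin (Real.pi * (y i - x i).val / s i) :=
  Finset.prod_congr rfl fun i hi => by
    rw [boxGroundState_off_add_of_ne x y (Finset.ne_of_mem_erase hi)]

/-- The factors in the directions `i ≠ ν` do not change under `y ↦ y − e_ν`. -/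
private theorem boxGroundState_rest_sub {N : ℕ} (x : TorusSite 4 N) (s : Fin 4 → ℕ)
    (y : TorusSite 4 N) (ν : Fin 4) :
    ∏ i ∈ Finset.univ.erase ν,
        Real.sin (Real.pi * ((y - Pi.single ν 1 : TorusSite 4 N) i - x i).val / s i) =
      ∏ i ∈ Finset.univ.erase ν, Real.sin (Real.pi * (y i - x i).val / s i) :=
  Finset.prod_congr rfl fun i hi => by
    rw [boxGroundState_off_sub_of_ne x y (Finset.ne_of_mem_erase hi)]

/-- Forward neighbour of a box site (side `s_ν ≤ N`): the box-restricted product at `y + e_ν` is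
`sin(π (t_ν + 1)/s_ν) · Π_{i≠ν} sin(π t_i/s_i)`; when `y + e_ν` leaves the box, `t_ν + 1 = s_ν`
and both sides vanish. -/
private theorem boxGroundState_prod_add {N : ℕ} [NeZero N] (x : TorusSite 4 N) (s : Fin 4 → ℕ)
    {y : TorusSite 4 N} (hy : siteBox x s y) (ν : Fin 4) (hs : s ν ≤ N) :
    (if siteBox x s (y + Pi.single ν 1) then
        ∏ i, Real.sin (Real.pi * ((y + Pi.single ν 1 : TorusSite 4 N) i - x i).val / s i) else 0) =
      Real.sin (Real.pi * ((y ν - x ν).val + 1) / s ν) *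
        ∏ i ∈ Finset.univ.erase ν, Real.sin (Real.pi * (y i - x i).val / s i) := by
  obtain ⟨_, h1⟩ := hy ν
  have hadd := boxGroundState_off_add_self x y ν
  by_cases hlt : (y ν - x ν).val + 1 < s ν
  · rw [Nat.mod_eq_of_lt (lt_of_lt_of_le hlt hs)] at hadd
    have hy' : siteBox x s (y + Pi.single ν 1) := by
      intro i
      by_cases hi : i = ν
      · rw [hi, hadd]; exact ⟨Nat.succ_pos _, hlt⟩
      · rw [boxGroundState_off_add_of_ne x y hi]; exact hy i
    rw [if_pos hy', boxGroundState_prod_eq x s (y + Pi.single ν 1) ν, boxGroundState_rest_add,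
      hadd, Nat.cast_add, Nat.cast_one]
  · have heq : (y ν - x ν).val + 1 = s ν := by omega
    have hy' : ¬ siteBox x s (y + Pi.single ν 1) := by
      intro h
      have h' := h ν
      rw [hadd] at h'
      rcases Nat.lt_or_ge ((y ν - x ν).val + 1) N with hN | hN
      · rw [Nat.mod_eq_of_lt hN] at h'; omega
      · have hN' : (y ν - x ν).val + 1 = N :=
          le_antisymm (Nat.lt_iff_add_one_le.1 (ZMod.val_lt _)) hN
        rw [hN', Nat.mod_self] at h'; exact lt_irrefl 0 h'.1
    rw [if_neg hy']
    have : ((y ν - x ν).val : ℝ) + 1 = (s ν : ℝ) := by exact_mod_cast heq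
    rw [this, boxGroundState_sin_self, zero_mul]

/-- Backward neighbour of a box site: the box-restricted product at `y − e_ν` is
`sin(π (t_ν − 1)/s_ν) · Π_{i≠ν} sin(π t_i/s_i)`; when `y − e_ν` leaves the box, `t_ν = 1` and both
sides vanish. -/
private theorem boxGroundState_prod_sub {N : ℕ} [NeZero N] (x : TorusSite 4 N) (s : Fin 4 → ℕ)
    {y : TorusSite 4 N} (hy : siteBox x s y) (ν : Fin 4) :
    (if siteBox x s (y - Pi.single ν 1) then
        ∏ i, Real.sin (Real.pi * ((y - Pi.single ν 1 : TorusSite 4 N) i - x i).val / s i) else 0) =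
      Real.sin (Real.pi * ((y ν - x ν).val - 1) / s ν) *
        ∏ i ∈ Finset.univ.erase ν, Real.sin (Real.pi * (y i - x i).val / s i) := by
  obtain ⟨h0, h1⟩ := hy ν
  have hsub := boxGroundState_off_sub_self x y ν h0
  by_cases hlt : 1 < (y ν - x ν).val
  · have hy' : siteBox x s (y - Pi.single ν 1) := by
      intro i
      by_cases hi : i = ν
      · rw [hi, hsub]; omega
      · rw [boxGroundState_off_sub_of_ne x y hi]; exact hy i
    rw [if_pos hy', boxGroundState_prod_eq x s (y - Pi.single ν 1) ν, boxGroundState_rest_sub,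
      hsub, Nat.cast_pred h0]
  · have heq : (y ν - x ν).val = 1 := by omega
    have hy' : ¬ siteBox x s (y - Pi.single ν 1) := by
      intro h
      have h' := h ν
      rw [hsub, heq] at h'
      exact lt_irrefl 0 h'.1
    rw [if_neg hy', heq, Nat.cast_one, sub_self, mul_zero, zero_div, Real.sin_zero, zero_mul]

/-- **The positive supersolution.**  There is `Φ ≥ 0` on the torus, positive exactly on the box
(namely `Φ(y) = Π_i sin(π t_i(y)/s_i)` on the box and `0` off it), with
`Σ_ν (Φ(y + e_ν) + Φ(y − e_ν)) = 2 (Σ_ν cos(π / s_ν)) Φ(y)` at every box site `y`. -/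
private theorem boxGroundState_supersolution {N : ℕ} [NeZero N] (x : TorusSite 4 N)
    (s : Fin 4 → ℕ) (hs : ∀ i, s i ≤ N) :
    ∃ Φ : TorusSite 4 N → ℝ, (∀ y, 0 ≤ Φ y) ∧ (∀ y, siteBox x s y → 0 < Φ y) ∧
      ∀ y, siteBox x s y → ∑ ν, (Φ (y + Pi.single ν 1) + Φ (y - Pi.single ν 1)) =
        2 * (∑ ν, Real.cos (Real.pi / s ν)) * Φ y := by
  obtain ⟨Φ, hΦ⟩ : ∃ Φ : TorusSite 4 N → ℝ, ∀ y, Φ y =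
      if siteBox x s y then ∏ i, Real.sin (Real.pi * (y i - x i).val / s i) else 0 :=
    ⟨_, fun _ => rfl⟩
  have hpos : ∀ y, siteBox x s y → 0 < Φ y := fun y hy => by
    rw [hΦ, if_pos hy]
    exact Finset.prod_pos fun i _ => boxGroundState_sin_pos (hy i).1 (hy i).2
  refine ⟨Φ, fun y => ?_, hpos, fun y hy => ?_⟩
  · by_cases hy : siteBox x s y
    · exact (hpos y hy).le
    · rw [hΦ, if_neg hy]
  · rw [Finset.mul_sum, Finset.sum_mul]
    refine Finset.sum_congr rfl fun ν _ => ?_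
    rw [hΦ (y + Pi.single ν 1), hΦ (y - Pi.single ν 1), hΦ y, if_pos hy,
      boxGroundState_prod_add x s hy ν (hs ν), boxGroundState_prod_sub x s hy ν, ← add_mul,
      boxGroundState_sin_add_sin, boxGroundState_prod_eq x s y ν]
    ring

/-! ### AM–GM, re-indexing, and the bound -/

/-- AM–GM with weights: `2ab ≤ a² q/p + b² p/q` for `p, q > 0`. -/
private theorem boxGroundState_amgm {a b p q : ℝ} (hp : 0 < p) (hq : 0 < q) :
    2 * (a * b) ≤ a ^ 2 * q / p + b ^ 2 * p / q := by
  rw [div_add_div _ _ hp.ne' hq.ne', le_div_iff₀ (mul_pos hp hq)]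
  nlinarith [sq_nonneg (a * q - b * p)]

/-- The termwise bound `2 f(y) f(y+e_ν) ≤ f(y)² Φ(y+e_ν)/Φ(y) + f(y+e_ν)² Φ(y)/Φ(y+e_ν)` for ALL
`y, ν` (with `x / 0 = 0`), for any `Φ ≥ 0` positive on the box: AM–GM when both sites lie in the
box, and otherwise the left-hand side vanishes (`f` is supported in the box) while the right-hand
side is non-negative. -/
private theorem boxGroundState_cross_le {N : ℕ} (x : TorusSite 4 N) (s : Fin 4 → ℕ)
    (f Φ : TorusSite 4 N → ℝ) (hf : ∀ y, ¬ siteBox x s y → f y = 0) (h0 : ∀ y, 0 ≤ Φ y)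
    (hpos : ∀ y, siteBox x s y → 0 < Φ y) (y : TorusSite 4 N) (ν : Fin 4) :
    2 * (f y * f (y + Pi.single ν 1)) ≤
      f y ^ 2 * Φ (y + Pi.single ν 1) / Φ y +
        f (y + Pi.single ν 1) ^ 2 * Φ y / Φ (y + Pi.single ν 1) := by
  by_cases h : siteBox x s y ∧ siteBox x s (y + Pi.single ν 1)
  · exact boxGroundState_amgm (hpos _ h.1) (hpos _ h.2)
  · have hzero : f y * f (y + Pi.single ν 1) = 0 := by
      rcases not_and_or.1 h with h | h
      · rw [hf _ h, zero_mul]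
      · rw [hf _ h, mul_zero]
    have h1 := h0 y
    have h2 := h0 (y + Pi.single ν 1)
    rw [hzero, mul_zero]
    positivity

/-- Summing the termwise bound over all sites and directions. -/
private theorem boxGroundState_twice_le {N : ℕ} [NeZero N] (x : TorusSite 4 N) (s : Fin 4 → ℕ)
    (f Φ : TorusSite 4 N → ℝ) (hf : ∀ y, ¬ siteBox x s y → f y = 0) (h0 : ∀ y, 0 ≤ Φ y)
    (hpos : ∀ y, siteBox x s y → 0 < Φ y) :
    2 * ∑ y, ∑ ν : Fin 4, f y * f (y + Pi.single ν 1) ≤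
      ∑ y, ∑ ν : Fin 4, (f y ^ 2 * Φ (y + Pi.single ν 1) / Φ y +
        f (y + Pi.single ν 1) ^ 2 * Φ y / Φ (y + Pi.single ν 1)) := by
  rw [Finset.mul_sum]
  refine Finset.sum_le_sum fun y _ => ?_
  rw [Finset.mul_sum]
  exact Finset.sum_le_sum fun ν _ => boxGroundState_cross_le x s f Φ hf h0 hpos y ν

/-- Re-indexing the second double sum by the torus translation `y ↦ y + e_ν`. -/
private theorem boxGroundState_reindex {N : ℕ} [NeZero N] (f Φ : TorusSite 4 N → ℝ) :
    ∑ y, ∑ ν : Fin 4, f (y + Pi.single ν 1) ^ 2 * Φ y / Φ (y + Pi.single ν 1) =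
      ∑ y, ∑ ν : Fin 4, f y ^ 2 * Φ (y - Pi.single ν 1) / Φ y := by
  rw [Finset.sum_comm]
  conv_rhs => rw [Finset.sum_comm]
  refine Finset.sum_congr rfl fun ν _ => ?_
  exact Fintype.sum_equiv (Equiv.addRight (Pi.single ν 1)) _ _ fun y => by
    simp only [Equiv.coe_addRight, add_sub_cancel_right]

/-- Pointwise in `y`: `Σ_ν f(y)² (Φ(y+e_ν) + Φ(y−e_ν)) / Φ(y) = 2 (Σ_i cos(π/s_i)) f(y)²`
(on the box by the supersolution identity, off the box because `f(y) = 0`). -/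
private theorem boxGroundState_pointwise {N : ℕ} [NeZero N] (x : TorusSite 4 N) (s : Fin 4 → ℕ)
    (f Φ : TorusSite 4 N → ℝ) (hf : ∀ y, ¬ siteBox x s y → f y = 0)
    (hpos : ∀ y, siteBox x s y → 0 < Φ y)
    (hsum : ∀ y, siteBox x s y → ∑ ν, (Φ (y + Pi.single ν 1) + Φ (y - Pi.single ν 1)) =
      2 * (∑ ν, Real.cos (Real.pi / s ν)) * Φ y)
    (y : TorusSite 4 N) :
    ∑ ν : Fin 4, (f y ^ 2 * Φ (y + Pi.single ν 1) / Φ y + f y ^ 2 * Φ (y - Pi.single ν 1) / Φ y) =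
      2 * (∑ i, Real.cos (Real.pi / s i)) * f y ^ 2 := by
  by_cases hy : siteBox x s y
  · have hΦ := (hpos y hy).ne'
    have key : ∀ ν : Fin 4,
        f y ^ 2 * Φ (y + Pi.single ν 1) / Φ y + f y ^ 2 * Φ (y - Pi.single ν 1) / Φ y =
          f y ^ 2 / Φ y * (Φ (y + Pi.single ν 1) + Φ (y - Pi.single ν 1)) := fun ν => by ring
    rw [Finset.sum_congr rfl fun ν _ => key ν, ← Finset.mul_sum, hsum y hy, div_mul_eq_mul_div,
      mul_div_assoc, mul_div_cancel_right₀ _ hΦ]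
    ring
  · simp [hf y hy]

/-- The total of the right-hand sides is `2 (Σ_i cos(π/s_i)) Σ_y f(y)²`. -/
private theorem boxGroundState_total {N : ℕ} [NeZero N] (x : TorusSite 4 N) (s : Fin 4 → ℕ)
    (f Φ : TorusSite 4 N → ℝ) (hf : ∀ y, ¬ siteBox x s y → f y = 0)
    (hpos : ∀ y, siteBox x s y → 0 < Φ y)
    (hsum : ∀ y, siteBox x s y → ∑ ν, (Φ (y + Pi.single ν 1) + Φ (y - Pi.single ν 1)) =
      2 * (∑ ν, Real.cos (Real.pi / s ν)) * Φ y) :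
    ∑ y, ∑ ν : Fin 4, (f y ^ 2 * Φ (y + Pi.single ν 1) / Φ y +
        f (y + Pi.single ν 1) ^ 2 * Φ y / Φ (y + Pi.single ν 1)) =
      2 * ((∑ i, Real.cos (Real.pi / s i)) * ∑ y, f y ^ 2) := by
  simp_rw [Finset.sum_add_distrib]
  rw [boxGroundState_reindex f Φ, ← Finset.sum_add_distrib]
  simp_rw [← Finset.sum_add_distrib]
  rw [Finset.sum_congr rfl fun y _ => boxGroundState_pointwise x s f Φ hf hpos hsum y,
    ← Finset.mul_sum, mul_assoc]

/-- **Stub `boxGroundState` (Dirichlet ground-state bound of an open box of the torus).**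
For every real function `f` on the sites of the torus `(ℤ/N)⁴` supported in the open box of corner
`x` and sides `s ≤ N` (`siteBox x s`: offsets `t_i = (y_i − x_i).val ∈ (0, s_i)`), the
nearest-neighbour form is bounded by the top of the box's Dirichlet spectrum:
`Σ_y Σ_ν f(y) f(y + e_ν) ≤ (Σ_i cos(π/s_i)) Σ_y f(y)²`.  Proof: ground-state substitution with the
positive supersolution `Φ(y) = Π_i sin(π t_i(y)/s_i)` (AM–GM termwise, re-indexing of the second
sum by the torus translation, and `Φ(y+e_ν) + Φ(y−e_ν) = 2cos(π/s_ν) Φ(y)` on the box). -/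
theorem stub_boxGroundState :
    ∀ (N : ℕ) [NeZero N] (x : TorusSite 4 N) (s : Fin 4 → ℕ) (f : TorusSite 4 N → ℝ),
      (∀ i, s i ≤ N) → (∀ y, ¬ siteBox x s y → f y = 0) →
      ∑ y, ∑ ν : Fin 4, f y * f (y + Pi.single ν 1) ≤ (∑ i, Real.cos (Real.pi / s i)) * ∑ y, f y ^ 2 := by
  intro N _ x s f hs hf
  obtain ⟨Φ, h0, hpos, hsum⟩ := boxGroundState_supersolution x s hs
  have h1 := boxGroundState_twice_le x s f Φ hf h0 hpos
  have h2 := boxGroundState_total x s f Φ hf hpos hsum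
  linarith

end Summit.QuantumFields.QCD.Cruxes.NegativeCellsDilute.MassWegnerCellIndex

end
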